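import Literature.Geometry.Kaehler.RiemannSurfaceChevalleyWeilFormula
import HarnessLib

/-!
# The rotation character is a conjugation invariant, `a_{g•P}(ghg⁻¹) = a_P(h)`, and the Chevalley–Weil formula
# grouped over the branch values: `μ_V = dim V^G + dim V·(γ − 1) + Σ_t Σ_α (α/m_t)·N_{t,α}`
# (Kopeliovich–Zemel Theorem 6.6 / Proposition 7.1; Chevalley–Weil 1934)

Layer `Literature/Geometry/Kaehler`, sequel of `RiemannSurfaceChevalleyWeilFormula` (the Chevalley–Weil formula as
a sum over the ramification POINTS: `Σ_h tr(h⁻¹|𝓗¹)χ_V(h) = |G|(dim V^G + dim V(γ − 1)) + Σ_{P : G_P ≠ 1} Σ_α α·N_{P,α}`)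
and of `RiemannSurfaceAutomorphismRotationGroup` (the rotation character `a_P = stabDeriv P : G_P → ℂ^×`, a
homomorphism, injective, `G_P` cyclic). The printed formula is a sum over the branch VALUES `q_t ∈ M/G`
(conjugacy classes `C` of local monodromy, `r_C` branch values each): S. Kopeliovich, S. Zemel, Israel J. Math.
234 (2019), as printed (arXiv copy pp. 28, 30):

> While the generator of the stabilizer of `P` (as well as the stabilizer itself) depends on the choice of `P`,
> the values we consider depend only on `C`, so that we get the same contribution from all the `n/o(C)` points
> lying over each of the `r_C` elements `η ∈ S` for which `ψ(η) = C` […] after multiplying by the number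
> `n r_C/o(C)` of points with this contribution, summing over `C`, and dividing by `n` we obtain the result […]
> **Proposition 7.1.** The multiplicity in which an element `ρ ∈ Irr_ℂ(G)` appears in `ρ_a` is
> `d_ρ(g_S − 1) + δ_{ρ,1} + Σ_C r_C Σ_{α=0}^{o(C)−1} N^ρ_{C,α}{α/o(C)}`.

That «the values we consider depend only on `C`» is, in the tree's language, the CONJUGATION INVARIANCE OF THE
ROTATION CHARACTER, `a_{g•P}(g h g⁻¹) = a_P(h)` (§1, by the chain rule in the charts at `P` and `g•P`: the chart
expression of `ghg⁻¹` factors as `(ψgφ⁻¹) ∘ (φhφ⁻¹) ∘ (φg⁻¹ψ⁻¹)` and the outer derivatives multiply to `1`), whence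
a generator `g_P` of `G_P` is transported to the generator `g g_P g⁻¹` of `G_{g•P}` with the same rotation number,
and `N_{g•P,α} = dim Eig(ρ(g g_P g⁻¹), ε^α) = dim Eig(ρ(g_P), ε^α) = N_{P,α}` (§2). Summing the point formula fibre
by fibre (`#π⁻¹(q_t) = |G|/m_t` points over `q_t`, all ramified) gives §3:

  `Σ_{h ∈ G} tr(h⁻¹|𝓗¹(M))·χ_V(h) = |G|·(dim V^G + dim V·(γ − 1)) + Σ_t #π⁻¹(q_t)·Σ_{α<m_t} α·N_{t,α}`, i.e.
  `|G|⁻¹ Σ_h tr(h|𝓗¹)χ_V(h⁻¹) = dim V^G + dim V·(γ − 1) + Σ_t Σ_{α=0}^{m_t−1} (α/m_t)·N_{t,α}`,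

the printed shape (for irreducible `V`, `dim V^G = δ_{V,1}`; the sources' `{−α/m}` in Theorem 6.6 / Theorem 2.10
index the eigenvalues through the inverse generator).

## What is formalized (everything proved; no definitions, no named facts, no instances)

* §1 **`stabDeriv_conj`** (`a_{g•P}(ghg⁻¹) = a_P(h)`, for any holomorphic action);
* §2 `finrank_eigenspace_conj` (`dim Eig(ρ(gxg⁻¹), μ) = dim Eig(ρ(x), μ)`), `forall_mem_zpowers_conj` (generators
  transport), `conj_smul_smul`, **`sum_mul_finrank_iInf_eigenspace_smul`** (`Σ_α α N_{g•P,α} = Σ_α α N_{P,α}`);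
* §3 `mem_support_ramificationDiv_iff_mk_mem_support_branchDiv`, `filter_support_ramificationDiv_mk_eq`,
  `sum_support_ramificationDiv_eq_sum_support_branchDiv` (fibrewise summation of a `G`-invariant quantity),
  **`chevalleyWeil_sum_trace_inv_mul_trace_eq_sum_branchValues`**, **`chevalleyWeil_multiplicity_eq_sum_branchValues`**.

## References

* S. Kopeliovich, S. Zemel, *On spaces associated with invariant divisors on Galois covers of Riemann surfaces and
  their applications*, Israel J. Math. 234 (2019), Theorem 6.6 (proof), Proposition 7.1 (arXiv:1609.02296 pp. 28, 30).
  [KopeliovichZemel2019]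
* C. Chevalley, A. Weil, Abh. Math. Sem. Hamburg 10 (1934), 358–361. [ChevalleyWeil1934Integrale]
* P. Frediani, A. Ghigi, M. Penegini, IMRN 2015, Theorem 2.10. [FredianiGhigiPenegini2015]
* H. Lange, R. E. Rodríguez, *Decomposition of Jacobians by Prym Varieties*, LNM 2310 (2022), Theorem 3.1.6 (proof:
  `G_q = g_q G_p g_q⁻¹`). [LangeRodriguez2022]
* R. Miranda, *Algebraic Curves and Riemann Surfaces*, GSM 5 (1995), Chapter III Proposition 3.1, Lemma 3.6. [Miranda1995]
-/

noncomputable section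

open scoped Manifold ContDiff Topology
open Set Filter Function Complex MulAction Module

namespace Literature.Geometry.Kaehler

namespace RiemannSurface

/-! ### §1 `a_{g•P}(g h g⁻¹) = a_P(h)`: the rotation number is a conjugation invariant -/

section Conj

variable {H M : Type*} [Group H] [MulAction H M] [TopologicalSpace M] [ChartedSpace ℂ M]
  [IsManifold 𝓘(ℂ, ℂ) ω M] (hhol : ∀ h : H, MDifferentiable 𝓘(ℂ, ℂ) 𝓘(ℂ, ℂ) fun x : M ↦ h • x)
include hhol

/-- **The rotation number is invariant under conjugation: `a_{g•P}(g h g⁻¹) = a_P(h)`** for `h ∈ H_P` (chain rule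
in the charts at `P` and `g•P`: the chart expression of `ghg⁻¹` at `g•P` factors as
`(ψ g φ⁻¹) ∘ (φ h φ⁻¹) ∘ (φ g⁻¹ ψ⁻¹)` and the outer derivatives multiply to `1`; «for any point `q` in
`f⁻¹(f(p))` … its stabilizer … satisfies `G_q = g_q G_p g_q⁻¹`», and the local monodromy data depends only on the
branch value). [cite: LangeRodriguez2022, Theorem 3.1.6 (proof)] [cite: KopeliovichZemel2019, Theorem 6.6 (proof:
«the generator of the stabilizer of `P` … depends on the choice of `P`, the values we consider depend only on `C`»)] -/
theorem stabDeriv_conj (g : H) {h : H} {P : M} (hh : h • P = P) :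
    stabDeriv (g • P) (g * h * g⁻¹) = stabDeriv P h := by
  set φ := chartAt ℂ P with hφ
  set ψ := chartAt ℂ (g • P) with hψ
  have hPs : P ∈ φ.source := mem_chart_source ℂ P
  have hgPs : g • P ∈ ψ.source := mem_chart_source ℂ (g • P)
  -- the three chart expressions
  set A : ℂ → ℂ := ψ ∘ (fun x : M ↦ g • x) ∘ φ.symm with hA
  set B : ℂ → ℂ := φ ∘ (fun x : M ↦ h • x) ∘ φ.symm with hB
  set C : ℂ → ℂ := φ ∘ (fun x : M ↦ g⁻¹ • x) ∘ ψ.symm with hC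
  have hC0 : C (ψ (g • P)) = φ P := by
    simp only [hC, comp_apply, ψ.left_inv hgPs, inv_smul_smul]
  have hB0 : B (φ P) = φ P := by
    simp only [hB, comp_apply, φ.left_inv hPs, hh]
  -- differentiability of the pieces
  have hAd : DifferentiableAt ℂ A (φ P) :=
    (analyticAt_chartExpr (f := fun x : M ↦ g • x) (x₀ := P) (hhol g P).continuousAt
      (Eventually.of_forall (hhol g))).differentiableAt
  have hBd : DifferentiableAt ℂ B (φ P) := (analyticAt_chartExpr_smul hhol hh).differentiableAt
  have hCd : DifferentiableAt ℂ C (ψ (g • P)) := by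
    have h1 := analyticAt_chartExpr (f := fun x : M ↦ g⁻¹ • x) (x₀ := g • P) (hhol g⁻¹ (g • P)).continuousAt
      (Eventually.of_forall (hhol g⁻¹))
    simp only [inv_smul_smul] at h1
    exact h1.differentiableAt
  -- points of `ψ.target` near `ψ (g • P)` whose `g⁻¹`-translate lands in `φ.source`, and then `h`-translate too
  have hn1 : ∀ᶠ z in 𝓝 (ψ (g • P)), g⁻¹ • ψ.symm z ∈ φ.source := by
    have hc : ContinuousAt (fun z ↦ g⁻¹ • ψ.symm z) (ψ (g • P)) :=
      ((hhol g⁻¹ _).continuousAt).comp_of_eq (ψ.continuousAt_symm (ψ.map_source hgPs)) rfl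
    have hv : g⁻¹ • ψ.symm (ψ (g • P)) = P := by rw [ψ.left_inv hgPs, inv_smul_smul]
    exact hc.eventually_mem (by rw [hv]; exact φ.open_source.mem_nhds hPs)
  have hn2 : ∀ᶠ z in 𝓝 (ψ (g • P)), h • (g⁻¹ • ψ.symm z) ∈ φ.source := by
    have hc : ContinuousAt (fun z ↦ h • (g⁻¹ • ψ.symm z)) (ψ (g • P)) :=
      ((hhol h _).continuousAt).comp_of_eq
        (((hhol g⁻¹ _).continuousAt).comp_of_eq (ψ.continuousAt_symm (ψ.map_source hgPs)) rfl) rfl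
    have hv : h • (g⁻¹ • ψ.symm (ψ (g • P))) = P := by rw [ψ.left_inv hgPs, inv_smul_smul, hh]
    exact hc.eventually_mem (by rw [hv]; exact φ.open_source.mem_nhds hPs)
  have hn3 : ∀ᶠ z in 𝓝 (ψ (g • P)), z ∈ ψ.target := ψ.open_target.mem_nhds (ψ.map_source hgPs)
  -- the chart expression of `g h g⁻¹` at `g • P` factors through the three pieces
  have hev : (ψ ∘ (fun x : M ↦ (g * h * g⁻¹) • x) ∘ ψ.symm) =ᶠ[𝓝 (ψ (g • P))] A ∘ (B ∘ C) := by
    filter_upwards [hn1, hn2] with z hz1 hz2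
    simp only [hA, hB, hC, comp_apply, φ.left_inv hz1, φ.left_inv hz2, mul_smul]
  -- and `A ∘ C = id` near `ψ (g • P)`
  have hev2 : (A ∘ C) =ᶠ[𝓝 (ψ (g • P))] id := by
    filter_upwards [hn1, hn3] with z hz1 hz3
    simp only [hA, hC, comp_apply, φ.left_inv hz1, smul_inv_smul, ψ.right_inv hz3, id]
  have hAC : deriv A (φ P) * deriv C (ψ (g • P)) = 1 := by
    have h1 := hev2.deriv_eq
    rw [deriv_id, deriv_comp _ (by rw [hC0]; exact hAd) hCd, hC0] at h1
    exact h1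
  -- the chain rule
  have hBCd : DifferentiableAt ℂ (B ∘ C) (ψ (g • P)) := (by rw [hC0]; exact hBd : DifferentiableAt ℂ B (C (ψ (g • P)))).comp _ hCd
  have hBC0 : (B ∘ C) (ψ (g • P)) = φ P := by rw [comp_apply, hC0, hB0]
  rw [stabDeriv, stabDeriv, hev.deriv_eq, deriv_comp _ (by rw [hBC0]; exact hAd) hBCd, hBC0,
    deriv_comp _ (by rw [hC0]; exact hBd) hCd, hC0]
  change deriv A (φ P) * (deriv B (φ P) * deriv C (ψ (g • P))) = deriv B (φ P)
  linear_combination deriv B (φ P) * hAC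

end Conj

/-! ### §2 The local data `m_P`, `N_{P,α}` are constant along the fibres of `π : M → M/G` -/

section Orbit

variable {M : Type*} [TopologicalSpace M] [ChartedSpace ℂ M] [IsManifold 𝓘(ℂ, ℂ) ω M]
  [CompactSpace M] [T2Space M] [PreconnectedSpace M] [Nonempty M] [Finite (autGroup M)]
  (G : Subgroup (autGroup M)) {V : Type*} [AddCommGroup V] [Module ℂ V] [FiniteDimensional ℂ V]
  (ρ : Representation ℂ ↥G V)

open OrbitSurface

omit [IsManifold 𝓘(ℂ, ℂ) ω M] [CompactSpace M] [T2Space M] [PreconnectedSpace M] [Nonempty M] [Finite ↥(autGroup M)]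
  [FiniteDimensional ℂ V] in
/-- **Conjugate elements have eigenspaces of the same dimension: `dim Eig(ρ(gxg⁻¹), μ) = dim Eig(ρ(x), μ)`**
(`ρ(g)` maps one onto the other). [cite: KopeliovichZemel2019, Theorem 6.6 (preamble: «independent of the choice of
`σ ∈ C`»)] -/
theorem finrank_eigenspace_conj (g x : ↥G) (μ : ℂ) :
    finrank ℂ ↥(Module.End.eigenspace (ρ (g * x * g⁻¹)) μ) = finrank ℂ ↥(Module.End.eigenspace (ρ x) μ) := by
  set e : V ≃ₗ[ℂ] V := LinearEquiv.ofLinear (ρ g) (ρ g⁻¹)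
    (by rw [← Module.End.mul_eq_comp, ← map_mul, mul_inv_cancel, map_one]; rfl)
    (by rw [← Module.End.mul_eq_comp, ← map_mul, inv_mul_cancel, map_one]; rfl) with he
  have hmap : Module.End.eigenspace (ρ (g * x * g⁻¹)) μ = (Module.End.eigenspace (ρ x) μ).map (e : V →ₗ[ℂ] V) := by
    ext v
    simp only [Module.End.mem_eigenspace_iff, Submodule.mem_map]
    constructor
    · intro hv
      refine ⟨ρ g⁻¹ v, ?_, ?_⟩
      · have h1 : ρ x (ρ g⁻¹ v) = ρ g⁻¹ (ρ (g * x * g⁻¹) v) := by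
          rw [← Module.End.mul_apply, ← map_mul, ← Module.End.mul_apply, ← map_mul]
          congr 1; group
        rw [h1, hv, map_smul]
      · change ρ g (ρ g⁻¹ v) = v
        rw [← Module.End.mul_apply, ← map_mul, mul_inv_cancel, map_one, Module.End.one_apply]
    · rintro ⟨w, hw, rfl⟩
      change ρ (g * x * g⁻¹) (ρ g w) = μ • ρ g w
      rw [← Module.End.mul_apply, ← map_mul, mul_assoc, inv_mul_cancel, mul_one, map_mul, Module.End.mul_apply, hw,
        map_smul]
  rw [hmap]
  exact LinearEquiv.finrank_map_eq e _

omit [IsManifold 𝓘(ℂ, ℂ) ω M] [CompactSpace M] [T2Space M] [PreconnectedSpace M] [Nonempty M]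
  [Finite ↥(autGroup M)] in
/-- **A generator transported along the orbit**: if `g_P` generates `G_P` then `g g_P g⁻¹` generates `G_{g•P}`
(«`G_q = g_q G_p g_q⁻¹`»). [cite: LangeRodriguez2022, Theorem 3.1.6 (proof)] -/
theorem forall_mem_zpowers_conj {P : M} {gP : ↥G} (hgP : gP • P = P)
    (hgen : ∀ u : stabilizer G P, u ∈ Subgroup.zpowers (⟨gP, mem_stabilizer_iff.2 hgP⟩ : stabilizer G P)) (g : ↥G)
    (hfix : (g * gP * g⁻¹) • (g • P) = g • P) :
    ∀ u : stabilizer G (g • P), u ∈ Subgroup.zpowers (⟨g * gP * g⁻¹, mem_stabilizer_iff.2 hfix⟩ : stabilizer G (g • P)) := by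
  intro u
  have hu : (u : ↥G) ∈ (stabilizer G P).map (MulAut.conj g).toMonoidHom := by
    rw [← stabilizer_smul_eq_stabilizer_map_conj]; exact u.2
  obtain ⟨v, hv, hvu⟩ := Subgroup.mem_map.1 hu
  obtain ⟨k, hk⟩ := Subgroup.mem_zpowers_iff.1 (hgen ⟨v, hv⟩)
  have hk' : gP ^ k = v := by simpa using congrArg Subtype.val hk
  refine Subgroup.mem_zpowers_iff.2 ⟨k, Subtype.ext ?_⟩
  simp only [SubgroupClass.coe_zpow]
  rw [← hvu, ← hk']
  simp only [MulEquiv.coe_toMonoidHom, MulAut.conj_apply, map_zpow]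

omit [IsManifold 𝓘(ℂ, ℂ) ω M] [CompactSpace M] [T2Space M] [PreconnectedSpace M] [Nonempty M]
  [Finite ↥(autGroup M)] in
/-- `(g g_P g⁻¹) • (g • P) = g • P`. [cite: LangeRodriguez2022, Theorem 3.1.6 (proof)] -/
theorem conj_smul_smul {P : M} {gP : ↥G} (hgP : gP • P = P) (g : ↥G) : (g * gP * g⁻¹) • (g • P) = g • P := by
  rw [mul_smul, mul_smul, inv_smul_smul, hgP]

omit [CompactSpace M] [Nonempty M] [FiniteDimensional ℂ V] in
/-- **The local Chevalley–Weil data are constant along the fibres of `π`**: with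
`N_{P,α} = dim ⋂_{h ∈ G_P} Eig(ρ(h), a_P(h)^α)` and `m_P = |G_P|`,
`Σ_{α<m_{gP}} α·N_{g•P,α} = Σ_{α<m_P} α·N_{P,α}` («we get the same contribution from all the `n/o(C)` points lying
over each of the `r_C` elements `η ∈ S`»). [cite: KopeliovichZemel2019, Theorem 6.6 (proof)] -/
theorem sum_mul_finrank_iInf_eigenspace_smul (g : ↥G) (P : M) :
    ∑ α ∈ Finset.range (Nat.card (stabilizer G (g • P))),
        (α : ℂ) * finrank ℂ ↥(⨅ h : ↥(stabilizer G (g • P)),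
          Module.End.eigenspace (ρ (h : ↥G)) (stabDeriv (g • P) (h : ↥G) ^ α)) =
      ∑ α ∈ Finset.range (Nat.card (stabilizer G P)),
        (α : ℂ) * finrank ℂ ↥(⨅ h : ↥(stabilizer G P),
          Module.End.eigenspace (ρ (h : ↥G)) (stabDeriv P (h : ↥G) ^ α)) := by
  obtain ⟨gen, hfix, hgen⟩ := exists_stabilizer_generators G
  have hfix' := conj_smul_smul G (hfix P) g
  have hgen' := forall_mem_zpowers_conj G (hfix P) (hgen P) g hfix'
  rw [card_stabilizer_smul]
  refine Finset.sum_congr rfl fun α _ ↦ ?_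
  rw [← eigenspace_eq_iInf_eigenspace_stabDeriv_pow G ρ hfix' hgen' α,
    ← eigenspace_eq_iInf_eigenspace_stabDeriv_pow G ρ (hfix P) (hgen P) α,
    stabDeriv_conj hhol_of_holomorphicSMul g (hfix P), finrank_eigenspace_conj]

/-! ### §3 The Chevalley–Weil formula grouped over the branch values -/

/-- A point is a ramification point of `π : M → M/G` iff its image is a branch value (all points of a fibre have
stabilizers of the same order `r_q`). [cite: Miranda1995, Chapter III Lemma 3.6] -/
theorem mem_support_ramificationDiv_iff_mk_mem_support_branchDiv (P : M) :
    P ∈ (ramificationDiv (mk G : M → OrbitSurface G M)).support ↔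
      mk G P ∈ (branchDiv (mk G : M → OrbitSurface G M)).support := by
  rw [mem_support_branchDiv_iff_two_le_stabOrder, stabOrder_mk, Finsupp.mem_support_iff,
    OrbitSurface.ramificationDiv_mk_apply]
  have h1 : 1 ≤ Nat.card (stabilizer G P) := Nat.card_pos
  omega

open Classical in
/-- Over a branch value `q`, the ramification points in the fibre are the whole fibre, `#π⁻¹(q) = |G|/r_q` points.
[cite: Miranda1995, Chapter III Lemma 3.6] -/
theorem filter_support_ramificationDiv_mk_eq {q : OrbitSurface G M}
    (hq : q ∈ (branchDiv (mk G : M → OrbitSurface G M)).support) :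
    (((ramificationDiv (mk G : M → OrbitSurface G M)).support.filter fun P ↦ mk G P = q) : Set M) =
      (mk G : M → OrbitSurface G M) ⁻¹' {q} := by
  ext P
  simp only [Finset.coe_filter, Set.mem_setOf_eq, Set.mem_preimage, Set.mem_singleton_iff]
  constructor
  · exact fun h ↦ h.2
  · intro h
    exact ⟨(mem_support_ramificationDiv_iff_mk_mem_support_branchDiv G P).2 (h ▸ hq), h⟩

open Classical in
/-- **Summing a fibre-constant quantity over the ramification points = summing over the branch values with the
weights `#π⁻¹(q_t) = |G|/m_t`** («multiplying by the number `n r_C/o(C)` of points with this contribution, summing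
over `C`»). [cite: KopeliovichZemel2019, Theorem 6.6 (proof)] -/
theorem sum_support_ramificationDiv_eq_sum_support_branchDiv (Φ : M → ℂ) (hΦ : ∀ (g : ↥G) (P : M), Φ (g • P) = Φ P) :
    ∑ P ∈ (ramificationDiv (mk G : M → OrbitSurface G M)).support, Φ P =
      ∑ q ∈ (branchDiv (mk G : M → OrbitSurface G M)).support,
        (((mk G : M → OrbitSurface G M) ⁻¹' {q}).ncard : ℂ) * Φ q.out := by
  rw [← Finset.sum_fiberwise_of_maps_to (g := (mk G : M → OrbitSurface G M))
    (t := (branchDiv (mk G : M → OrbitSurface G M)).support)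
    (fun P hP ↦ (mem_support_ramificationDiv_iff_mk_mem_support_branchDiv G P).1 hP)]
  refine Finset.sum_congr rfl fun q hq ↦ ?_
  have hconst : ∀ P ∈ (ramificationDiv (mk G : M → OrbitSurface G M)).support.filter (fun P ↦ mk G P = q),
      Φ P = Φ q.out := by
    intro P hP
    have hPq : mk G P = q := (Finset.mem_filter.1 hP).2
    obtain ⟨g, hg⟩ : ∃ g : ↥G, g • q.out = P := mk_eq_mk_iff.1 (by rw [mk_out, hPq])
    rw [← hg, hΦ]
  rw [Finset.sum_congr rfl hconst, Finset.sum_const, nsmul_eq_mul, ← Set.ncard_coe_finset,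
    filter_support_ramificationDiv_mk_eq G hq]

open Classical in
/-- **THE CHEVALLEY–WEIL FORMULA, grouped over the branch values `q_t` of `π : M → M/G`:**
`Σ_{h ∈ G} tr(h⁻¹|𝓗¹(M))·χ_V(h) = |G|·(dim V^G + dim V·(γ − 1)) + Σ_t #π⁻¹(q_t)·Σ_{α=0}^{m_t−1} α·N_{t,α}`, with
`m_t = r_{q_t}` the common stabilizer order over `q_t`, `#π⁻¹(q_t) = |G|/m_t`, and `N_{t,α}` the multiplicity of
`a_{P_t}^α` in `V|_{G_{P_t}}` at the point `P_t = q_t.out` (any point over `q_t` gives the same value: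
`sum_mul_finrank_iInf_eigenspace_smul`). [cite: KopeliovichZemel2019, Theorem 6.6, Proposition 7.1]
[cite: ChevalleyWeil1934Integrale] [cite: FredianiGhigiPenegini2015, Theorem 2.10] -/
theorem chevalleyWeil_sum_trace_inv_mul_trace_eq_sum_branchValues [Fintype ↥G] [DecidableEq ↥G] :
    ∑ h : ↥G, LinearMap.trace ℂ ↥(holomorphicOneForms M) (oneFormRep M ((h⁻¹ : ↥G) : autGroup M)) *
        LinearMap.trace ℂ V (ρ h) =
      Nat.card ↥G * ((finrank ℂ ↥ρ.invariants : ℂ) +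
        (finrank ℂ V : ℂ) * ((arithGenus (OrbitSurface G M) : ℂ) - 1)) +
      ∑ q ∈ (branchDiv (mk G : M → OrbitSurface G M)).support,
        (((mk G : M → OrbitSurface G M) ⁻¹' {q}).ncard : ℂ) *
          ∑ α ∈ Finset.range (stabOrder q),
            (α : ℂ) * finrank ℂ ↥(⨅ h : ↥(stabilizer G q.out),
              Module.End.eigenspace (ρ (h : ↥G)) (stabDeriv q.out (h : ↥G) ^ α)) := by
  rw [chevalleyWeil_sum_trace_inv_mul_trace_eq_iInf G ρ,
    sum_support_ramificationDiv_eq_sum_support_branchDiv G _ (sum_mul_finrank_iInf_eigenspace_smul G ρ)]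
  rfl

open Classical in
/-- **THE CHEVALLEY–WEIL FORMULA in the printed shape `Σ_t Σ_α N_{t,α}·(α/m_t)`**: for every finite-dimensional
complex representation `(V, ρ)` of `G ≤ Aut M`,
`|G|⁻¹ Σ_{h ∈ G} tr(h|𝓗¹(M))·χ_V(h⁻¹) = dim V^G + dim V·(γ − 1) + Σ_t Σ_{α=0}^{m_t−1} (α/m_t)·N_{t,α}`;
for irreducible `V` (`dim V^G = δ_{V,1}`) this is «the multiplicity in which `ρ ∈ Irr_ℂ(G)` appears … is
`d_ρ(g_S − 1) + δ_{ρ,1} + Σ_C r_C Σ_{α=0}^{o(C)−1} N^ρ_{C,α}{α/o(C)}`» (each branch value counted once; in Theorem 6.6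
and Theorem 2.10 the eigenvalue index is taken through the inverse generator, `{−α/m}`).
[cite: KopeliovichZemel2019, Proposition 7.1, Theorem 6.6] [cite: ChevalleyWeil1934Integrale]
[cite: FredianiGhigiPenegini2015, Theorem 2.10] -/
theorem chevalleyWeil_multiplicity_eq_sum_branchValues [Fintype ↥G] [DecidableEq ↥G] :
    (Nat.card ↥G : ℂ)⁻¹ * ∑ h : ↥G, LinearMap.trace ℂ ↥(holomorphicOneForms M) (oneFormRep M (h : autGroup M)) *
        LinearMap.trace ℂ V (ρ h⁻¹) =
      (finrank ℂ ↥ρ.invariants : ℂ) + (finrank ℂ V : ℂ) * ((arithGenus (OrbitSurface G M) : ℂ) - 1) +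
      ∑ q ∈ (branchDiv (mk G : M → OrbitSurface G M)).support,
        ∑ α ∈ Finset.range (stabOrder q),
          (α : ℂ) / (stabOrder q : ℂ) * finrank ℂ ↥(⨅ h : ↥(stabilizer G q.out),
            Module.End.eigenspace (ρ (h : ↥G)) (stabDeriv q.out (h : ↥G) ^ α)) := by
  have hG : (Nat.card ↥G : ℂ) ≠ 0 := Nat.cast_ne_zero.2 Nat.card_pos.ne'
  rw [sum_trace_mul_trace_inv_eq, chevalleyWeil_sum_trace_inv_mul_trace_eq_sum_branchValues, mul_add, ← mul_assoc,
    inv_mul_cancel₀ hG, one_mul, Finset.mul_sum]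
  congr 1
  refine Finset.sum_congr rfl fun q _ ↦ ?_
  have hr : (stabOrder q : ℂ) ≠ 0 := Nat.cast_ne_zero.2 (Nat.one_le_iff_ne_zero.1 (one_le_stabOrder q))
  have hcard : (((mk G : M → OrbitSurface G M) ⁻¹' {q}).ncard : ℂ) = Nat.card ↥G / (stabOrder q : ℂ) := by
    rw [eq_div_iff hr, ← Nat.cast_mul, ncard_preimage_mk_mul_stabOrder]
  rw [hcard, Finset.mul_sum, Finset.mul_sum]
  refine Finset.sum_congr rfl fun α _ ↦ ?_
  field_simp

end Orbit

end RiemannSurface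

end Literature.Geometry.Kaehler

end
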